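import Summits.Ventures.DiscreteObjects.PP12.OrderElevenHomology
import Summits.Ventures.DiscreteObjects.PP12.OrderElevenTriangleValid
import Summits.Ventures.DiscreteObjects.PP12.OrderThirteenReduction

/-!
# PP(12), order-11 cell: the plane ⇒ array reduction in the kernel (`NoCollineationOfOrderEleven → NoOrderElevenOrder12`) and the all-finite rigid endgame
Framing: lottery ticket; floor = certified bounds/negative ranges.

Cell pub-namedobj (venture DiscreteObjects), target (M), designs gen 16. `OrderElevenCollineation` TYPES the two normal forms of a projective
plane of order 12 with a collineation `σ` of order 11 — Case A (homology): a `QdmRows 11 13` array, census statement `NoHomologyArray12`;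
Case B (triangle): `TriangleData 11` / `TriangleData.Valid`, census statement `NoTriangleData12`; both decided EMPTY outside the kernel
(designs E1 `caseA.c` = `caseA.py`, `caseB.c` / `caseB.py`, farm twin j097463) and in print (Janko–van Trung 1982) — and their conjunction
`NoCollineationOfOrderEleven`. With `PrimeOrderStructure.order12_q11_axis_or_two` (homology, or two fixed points on every fixed line),
`OrderElevenHomology.no_homology11_of_noHomologyArray12` (Case A ⇒ array) and `OrderElevenTriangleValid.triData11_valid` (Case B ⇒ the
fixed structure is a triangle, `OrderElevenTriangle`, and the plane's `TriangleData 11` is valid) the paper step "plane ⇒ arrays"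
(FAMILY-B1P Lemma 4, §2, §3) is now a kernel theorem:

* **`noOrderEleven_of_noCollineationOfOrderEleven : NoCollineationOfOrderEleven → NoOrderElevenOrder12`**;
* **`collineationGroupIsTwoThreeGroup_of_arrays`**: Janko–van Trung's named fact `CollineationGroupIsTwoThreeGroup` from the three FINITE
  statements `NoFanoFiveIncMatrix` (p = 5), `NoCollineationOfOrderEleven` (p = 11), `NoLiftData13` (p = 13);
* **`card_collineationGroup_eq_one_v13`** — the rigid endgame with EVERY hypothesis a typed finite array / orbit-matrix statement:
  `NoLiftableSTD2_12_6` (p = 2), `NoLiftableSTD3_12_4`, `NoFlagOrbitMatrix 4`, `NoFlagOrbitMatrix 3`, `NoFlagSevenOrbitMatrix`,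
  `NoFlagTenOrbitMatrix` (p = 3), `NoFanoFiveIncMatrix` (p = 5), `NoCollineationOfOrderEleven` (p = 11), `NoLiftData13` (p = 13)
  ⇒ every collineation group of every projective plane of order 12 is trivial.

Census status of the hypotheses is unchanged by this file (EMPTY outside the kernel: p = 2, 3-elation, f = 10, p = 5 (g10 model), p = 11,
p = 13; UNDECIDED: `NoFlagOrbitMatrix 4`, `NoFlagOrbitMatrix 3`, `NoFlagSevenOrbitMatrix`); nothing here asserts any of them. No `sorry`, no new
axioms.
-/

namespace Summit.Ventures.DiscreteObjects.PP12

open Configuration Finset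
open scoped Classical

/-- **Kernel reduction of the order-11 cell: `NoCollineationOfOrderEleven → NoOrderElevenOrder12`.** -/
theorem noOrderEleven_of_noCollineationOfOrderEleven (h : NoCollineationOfOrderEleven) : NoOrderElevenOrder12 := by
  intro P L _ _ _ _ h12 σ hq
  by_contra hne
  rcases σ.order12_q11_axis_or_two h12 hne hq with hA | hB
  · exact σ.no_homology11_of_noHomologyArray12 h.1 h12 hne hq hA
  · exact h.2 _ (σ.triData11_valid h12 hq hB)

open Literature.Combinatorics.Designs in
/-- **Janko–van Trung's `{2,3}`-group theorem from three finite array statements** (p = 5, 11, 13). -/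
theorem collineationGroupIsTwoThreeGroup_of_arrays (h5 : NoFanoFiveIncMatrix) (h11 : NoCollineationOfOrderEleven) (h13 : NoLiftData13) :
    CollineationGroupIsTwoThreeGroup :=
  collineationGroupIsTwoThreeGroup_of_cells (noOrderFive_of_noFanoFiveIncMatrix h5) (noOrderEleven_of_noCollineationOfOrderEleven h11)
    (noOrderThirteen_of_noLiftData13 h13)

open Literature.Combinatorics.Designs Summit.Ventures.DiscreteObjects.STD in
/-- **Rigid endgame, v13 (all hypotheses finite):** the typed array / orbit-matrix statements of the cells `p = 2, 3, 5, 11, 13` force every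
collineation group of a projective plane of order 12 to be trivial. -/
theorem card_collineationGroup_eq_one_v13 (h2 : NoLiftableSTD2_12_6) (h3E : NoLiftableSTD3_12_4)
    (h4 : NoFlagOrbitMatrix 4) (h3 : NoFlagOrbitMatrix 3) (h7 : NoFlagSevenOrbitMatrix) (h10 : NoFlagTenOrbitMatrix)
    (h5 : NoFanoFiveIncMatrix) (h11 : NoCollineationOfOrderEleven) (h13 : NoLiftData13)
    (P L : Type) [Membership P L] [Fintype P] [Fintype L] [ProjectivePlane P L] (h12 : ProjectivePlane.order P L = 12)
    (G : Type) [Group G] [Fintype G] [MulAction G P] [MulAction G L] (hG : IsCollineationGroup G P L) :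
    Fintype.card G = 1 :=
  card_collineationGroup_eq_one_v10 h2 h3E h4 h3 h7 h10 h5 (noOrderEleven_of_noCollineationOfOrderEleven h11)
    (noOrderThirteen_of_noLiftData13 h13) P L h12 G hG

end Summit.Ventures.DiscreteObjects.PP12
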